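import Summits.SmoothPoincare4.SmoothPoincare4.Theorems.ConvexBisectionAcyclicBisectionExistsStubModelsOnCounts
import Summits.SmoothPoincare4.SmoothPoincare4.Theorems.ConvexBisectionAcyclicBisectionExistsMultiAttachmentH1
import Literature.Topology.FourManifolds.LefschetzBaseBetti
import HarnessLib

/-!
# The classes of a one-sided Lefschetz model of a homotopy 4-sphere span `ℚ^{2g}`, unconditionally
(sub-goal `stub_modelsOn_counts_span` of stub `stub_modelsOn_counts`, line `modp-braid-orbits`, reshape r9,
crux `ConvexBisection.AcyclicBisectionExists`, item stmt-SmoothPoincare4-10508; wave 4 / W4-E)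

The second clause of the named fact `LefschetzBase.modelsOn_counts_of_homotopyEquiv_sphere`
(Gompf–Stipsicz 1999, §8.2; Etnyre–Fuller 2006, §2), now WITHOUT hypotheses: if `M ≃ₕ S⁴` and
`ModelsOn M g l` (`M = X ∪_Ψ Base g`, `X = X(F_{g,1}; l)` the Lefschetz handlebody of the signed word `l`)
then `Submodule.span ℚ (letters (ratWord l)) = ⊤`.  On paper: `H₁(X; ℤ) ≅ ℤ^{2g}/⟨classes⟩` and
`H₁(X; ℚ) = H₁(M; ℚ) = 0` (the cap `Base g ≅ F × D²` has `H₂(Base g; ℚ) = 0`, so `H₂(M, X; ℚ) = 0`), hence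
`ℤ^{2g}/⟨classes⟩` is torsion and the classes span rationally.  Assembly of three accepted inputs:

* `span_letters_ratWord_eq_top_of_gluing_base` (`…StubModelsOnCounts.lean`, p113042): for ANY boundary
  gluing `M = X ∪_Ψ Base g` of a homotopy 4-sphere with `H₂(Base g; ℚ) = 0` and
  `H₁(X; ℤ) ≃ₗ[ℤ] ℤ^{2g} ⧸ span (letters l)`, the classes span `ℚ^{2g}` (excision for the gluing, Lefschetz
  duality, finiteness of `H₁(X; ℤ)`, rank–nullity);
* `stub_isLefschetzHandlebody_homology_H1` (`…MultiAttachmentH1.lean`, p122550) = clause 2 of NF5: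
  `IsLefschetzHandlebody g l X → H₁(X; ℤ) ≃ₗ[ℤ] ℤ^{2g} ⧸ span (letters l)` (Mayer–Vietoris over the Kosinski
  multi-attachment and Milnor's chain shadow `exists_isChainShadow_holds`);
* `LefschetzBase.isZero_singularHomology_base_of_two_le` (`LefschetzBaseBetti.lean`, p120614):
  `H₂(Base g; ℚ) = 0` (Milnor 1968, Thm. 9.1, by Mayer–Vietoris over the Milnor cover).

By-product `modelsOn_handlebody_homologyOne` — the `ModelsOn` clause unfolded with all three facts about
its handlebody side.  No definitions, no named facts, no `sorry`.
-/

noncomputable section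

-- the prescribed namespace `Summit.<P>.<Sub>.…` duplicates `SmoothPoincare4` (P = Sub)
set_option linter.dupNamespace false

open scoped Manifold ContDiff Topology ContinuousMap
open Set Function CategoryTheory CategoryTheory.Limits
open Literature.GroupTheory.CombinatorialGroupTheory.SignedHurwitz Literature.Topology.FourManifolds
  Literature.Topology.FourManifolds.LefschetzBase Literature.AlgebraicTopology.SingularHomology

namespace Summit.SmoothPoincare4.SmoothPoincare4.Theorems.AcyclicBisectionExists.ModpBraidOrbits

variable {M : Type} [TopologicalSpace M] [T2Space M] [SecondCountableTopology M]
  [ChartedSpace (EuclideanSpace ℝ (Fin 4)) M] [IsManifold (𝓡 4) ∞ M]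

omit [T2Space M] [SecondCountableTopology M] [IsManifold (𝓡 4) ∞ M] in
/-- **The handlebody side of a one-sided model, with its first homology**: `ModelsOn M g l` unfolded,
together with `H₁(X; ℤ) ≃ₗ[ℤ] ℤ^{2g} ⧸ span (letters l)` (clause 2 of NF5, Gompf–Stipsicz 1999 §8.2) for its
Lefschetz handlebody `X`. [cite: GompfStipsicz1999, §8.2] -/
theorem modelsOn_handlebody_homologyOne {g : ℕ} {l : List ((Fin g ⊕ Fin g → ℤ) × Bool)}
    (hM : ModelsOn M g l) :
    ∃ (X : Type) (_ : TopologicalSpace X) (_ : T2Space X) (_ : SecondCountableTopology X)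
      (_ : CompactSpace X) (_ : ChartedSpace (EuclideanHalfSpace 4) X) (_ : IsManifold (𝓡∂ 4) ∞ X)
      (bX : BoundaryData (𝓡∂ 4) X (𝓡 3)) (Ψ : bX.carrier ≃ₘ⟮𝓡 3, 𝓡 3⟯ (bBase g).carrier),
      IsLefschetzHandlebody g l X ∧ IsBoundaryGluing bX (bBase g) Ψ (𝓡 4) M ∧
        Nonempty (singularHomology ℤ ℤ X 1 ≃ₗ[ℤ] ((Fin g ⊕ Fin g → ℤ) ⧸ Submodule.span ℤ (letters l))) := by
  obtain ⟨X, _, _, _, _, _, _, bX, Ψ, hX, hglue⟩ := hM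
  exact ⟨X, inferInstance, inferInstance, inferInstance, inferInstance, inferInstance, inferInstance, bX, Ψ,
    hX, hglue, stub_isLefschetzHandlebody_homology_H1 g l X hX⟩

/-- **Clause 2 of NF2 on `ModelsOn`, unconditionally**: for a one-sided Lefschetz model `ModelsOn M g l` of
a homotopy 4-sphere `M`, the classes of `l` span `ℚ^{2g}` — `span_letters_ratWord_eq_top_of_gluing_base`
with `hB2 := isZero_singularHomology_base_of_two_le ℚ ℚ g le_rfl` and `hX1` from clause 2 of NF5.
[cite: GompfStipsicz1999, §8.2] -/
theorem span_letters_ratWord_eq_top_of_modelsOn {g : ℕ} {l : List ((Fin g ⊕ Fin g → ℤ) × Bool)}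
    (e : M ≃ₕ Metric.sphere (0 : EuclideanSpace ℝ (Fin 5)) 1) (hM : ModelsOn M g l) :
    Submodule.span ℚ (letters (ratWord l)) = ⊤ := by
  obtain ⟨X, _, _, _, _, _, _, bX, Ψ, -, hglue, hX1⟩ := modelsOn_handlebody_homologyOne hM
  exact span_letters_ratWord_eq_top_of_gluing_base e bX Ψ hglue
    (isZero_singularHomology_base_of_two_le ℚ ℚ g le_rfl) hX1

/-- **Sub-goal `stub_modelsOn_counts_span` of stub `stub_modelsOn_counts`** (line `modp-braid-orbits`, r9):
the second clause of `LefschetzBase.modelsOn_counts_of_homotopyEquiv_sphere` (Gompf–Stipsicz 1999, §8.2;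
Etnyre–Fuller 2006, §2) for every one-sided Lefschetz model `ModelsOn M g l` of a homotopy 4-sphere `M`,
unconditionally: the classes of `l`, read over `ℚ`, span `ℚ^{2g}` (`H₁(X; ℤ) ≅ ℤ^{2g}/⟨classes⟩` is torsion
because `H₁(X; ℚ) = H₁(M; ℚ) = 0`). [cite: GompfStipsicz1999, §8.2] -/
theorem stub_modelsOn_counts_span :
    ∀ (M : Type) [TopologicalSpace M] [T2Space M] [SecondCountableTopology M]
      [ChartedSpace (EuclideanSpace ℝ (Fin 4)) M] [IsManifold (𝓡 4) ∞ M] (g : ℕ)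
      (l : List ((Fin g ⊕ Fin g → ℤ) × Bool)),
      M ≃ₕ Metric.sphere (0 : EuclideanSpace ℝ (Fin 5)) 1 → ModelsOn M g l →
        Submodule.span ℚ (letters (ratWord l)) = ⊤ :=
  fun _ _ _ _ _ _ _ _ e hM => span_letters_ratWord_eq_top_of_modelsOn e hM

end Summit.SmoothPoincare4.SmoothPoincare4.Theorems.AcyclicBisectionExists.ModpBraidOrbits

end
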